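import Summits.QuantumFields.YangMills.Theorems.UnitScaleTiltFluctuationComparisonRegPrGlobalSlackKernelLegWeighted
import HarnessLib

/-!
# `UnitScaleTiltFluctuationComparisonRegPrGlobalSlackLegKernelPointwiseT3` — THE I-11 ROW (43) `KernelLegPointwiseΦ` IS DOWNSTREAM OF THE DISPLAY ROW (R2′), BY NAME: the weighted
# operator-norm kernel row `KernelLegΦ` (⇐ (R2′) leg-weighted analyticity by Cauchy, ✓`kernelLegΦ_of_chartAnalyticLeg`) GIVES BACK print's pointwise per-leg shape at the weight rate
# (crux `FluctuationComparisonRegPrIntL`, stmt-QuantumFields-20520, skeletons v5kC / v5kD, STUB 3⁗χ; cell `pub/ym-inputs`, seat ym-inputs-p11 = INPUT-LIST I-11 row `KernelLegPointwiseΦ`;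
# count-neutral helper, def-free, registry untouched)

WHY.  The I-11 row `KernelLegPointwiseΦ D Φ dist κ₁ κ A` (`…KernelLegEndToEnd`: print's (43) p.266 «|𝒫_j(Y_j)| ≤ O(1)·Π_i exp(−κ₁(M₁Lʲη)⁻¹|c_{i,−} − y|)» read on the monomials of the flat
kernels) and the WEIGHTED row `KernelLegΦ D Φ dist κ′ κ C_E` (`…KernelLegWeights`: `‖ker Φ ∘ D_w^{⊗d}‖ ≤ C_E·e^{−κ𝓛}`, the object (45)'s summation uses) are two currencies for the same
decay: `kernelLegΦ_of_pointwise` (✓, `…EndToEnd`) goes pointwise ⟹ weighted at any `κ′ < κ₁` paying the leg summability `S⁶`; THIS file goes back, loss-free at the weight rate: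
`KernelLegΦ … κ′ κ C_E ⟹ KernelLegPointwiseΦ … κ′ κ C_E` (evaluate the weighted form on the rescaled monomial `(D_w⁻¹δ_{c_i}v_i)_i`, whose sup norms are `e^{−κ′d(c_i)}‖v_i‖`).  So the
display of record's (R2′) `ChartAnalyticΦ D (rescaleΦw dist κ′ Φ) κ ρ C_A` delivers p11's row BY NAME: `kernelLegPointwiseΦ_of_chartAnalyticLeg`.  What is NOT here: (R2′) itself for the
canonical birth charts (needs the propagator-chain structure of the step charts, p.264 L20–24 — an (α)-record display).  Nothing of [Balaban1985UV3] / [King1986] asserted; no summit /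
rung / gap claim (YM₃ on T³ is ladder rung R3, not the Clay problem).

References: T. Bałaban, CMP 102 (1985) 255–275 [Balaban1985UV3] ((43)–(45) pp.266–267, p.264 L20–24, Prop. 3 (34) p.264); C. King, CMP 102 (1986) 649–677 [King1986] (Prop. 3.6
(3.55)–(3.56) p.662).
-/

set_option autoImplicit false

noncomputable section

open scoped BigOperators
open Literature.MathematicalPhysics.QuantumFieldTheory.Balaban1983to89
open Literature.MathematicalPhysics.QuantumFieldTheory.Balaban1983to89.T3ContinuumYM3Torus
open Literature.MathematicalPhysics.QuantumFieldTheory.Balaban1983to89.T3AlphaInputsAC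
open Summit.QuantumFields.YangMills.Theorems
open Summit.QuantumFields.YangMills.Theorems.GlobalSlackKernelMatching

namespace Summit.QuantumFields.YangMills.Theorems.GlobalSlackKernelLeg

section Pointwise

variable {𝕍 : Type} [NormedAddCommGroup 𝕍] [NormedSpace ℂ 𝕍] {F : T3Family} {γ : ℝ}

/-- The rescaled monomial leg: `D_w⁻¹(δ_c v) = δ_c (e^{−κ′d(c)}·v)`. [folklore] -/
theorem legD_symm_single (dist : LegDist F) (κ' : ℝ) (K b : ℕ) (Y : Set (Site (F.P K) 0)) (c : PBond (F.P K) b) (v : 𝕍) :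
    (legD 𝕍 dist κ' K b Y).symm (Pi.single c v) = Pi.single c ((legW dist κ' K b Y c)⁻¹ • v) := by
  classical
  funext c'
  rw [legD_symm_apply]
  by_cases h : c' = c
  · subst h; simp only [Pi.single_eq_same]
  · simp only [Pi.single_eq_of_ne h, smul_zero]

/-- Its sup norm: `‖D_w⁻¹(δ_c v)‖ = e^{−κ′d(c)}·‖v‖`. [folklore] -/
theorem norm_legD_symm_single (dist : LegDist F) (κ' : ℝ) (K b : ℕ) (Y : Set (Site (F.P K) 0)) (c : PBond (F.P K) b) (v : 𝕍) :
    ‖(legD 𝕍 dist κ' K b Y).symm (Pi.single c v)‖ = Real.exp (-(κ' * dist K b Y c)) * ‖v‖ := by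
  classical
  rw [legD_symm_single, Pi.norm_single, norm_smul, norm_legW_inv]

/-- **THE WEIGHTED KERNEL ROW GIVES PRINT'S POINTWISE (43) AT THE WEIGHT RATE, LOSS-FREE**: `KernelLegΦ D Φ dist κ′ κ C_E → KernelLegPointwiseΦ D Φ dist κ′ κ C_E` — the monomial
`(δ_{c_i}v_i)_i` is `D_w^{⊗d}` of `(D_w⁻¹δ_{c_i}v_i)_i`, so `‖ker(δ_{c₁}v₁,…)‖ ≤ ‖ker ∘ D_w^{⊗d}‖·Π_i e^{−κ′d(c_i)}‖v_i‖`. [cite: Balaban1985UV3, (43) p.266, (45) p.267] -/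
theorem kernelLegPointwiseΦ_of_kernelLegΦ {D : AlphaDataT3 F γ} {Φ : ChartFam 𝕍 F} {dist : LegDist F} {κ' κ C_E : ℝ}
    (h : KernelLegΦ D Φ dist κ' κ C_E) : KernelLegPointwiseΦ D Φ dist κ' κ C_E := by
  classical
  intro K k b Y hY d hd c v
  have hw := h K k b Y hY d hd
  set M := ker Φ K b Y d with hM
  set z : Fin d → (PBond (F.P K) b → 𝕍) := fun i => (legD 𝕍 dist κ' K b Y).symm (Pi.single (c i) (v i)) with hz
  have happ : M (fun i => Pi.single (c i) (v i)) = (M.compContinuousLinearMap fun _ => legL 𝕍 dist κ' K b Y) z := by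
    rw [ContinuousMultilinearMap.compContinuousLinearMap_apply]
    congr 1
    funext i
    rw [hz, legL_apply, ContinuousLinearEquiv.apply_symm_apply]
  rw [happ]
  refine (ContinuousMultilinearMap.le_opNorm _ z).trans ?_
  have hz' : ∏ i, ‖z i‖ = (∏ i, Real.exp (-(κ' * dist K b Y (c i)))) * ∏ i, ‖v i‖ := by
    rw [← Finset.prod_mul_distrib]
    exact Finset.prod_congr rfl fun i _ => by rw [hz]; exact norm_legD_symm_single dist κ' K b Y (c i) (v i)
  rw [hz']
  have h0 : 0 ≤ (∏ i, Real.exp (-(κ' * dist K b Y (c i)))) * ∏ i, ‖v i‖ :=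
    mul_nonneg (Finset.prod_nonneg fun i _ => (Real.exp_pos _).le) (Finset.prod_nonneg fun i _ => norm_nonneg _)
  calc ‖M.compContinuousLinearMap fun _ => legL 𝕍 dist κ' K b Y‖ * ((∏ i, Real.exp (-(κ' * dist K b Y (c i)))) * ∏ i, ‖v i‖)
      ≤ C_E * Real.exp (-κ * D.treeLen K (1 + b) Y) * ((∏ i, Real.exp (-(κ' * dist K b Y (c i)))) * ∏ i, ‖v i‖) :=
        mul_le_mul_of_nonneg_right hw h0
    _ = _ := by ring

/-- **(R2′) GIVES THE I-11 ROW BY NAME**: leg-weighted analyticity `ChartAnalyticΦ D (rescaleΦw dist κ′ Φ) κ ρ C_A` ⟹ `KernelLegPointwiseΦ D Φ dist κ′ κ (C_A·max(1,12/ρ)⁶)`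
(`kernelLegΦ_of_chartAnalyticLeg`, then `kernelLegPointwiseΦ_of_kernelLegΦ`). [cite: Balaban1985UV3, Prop. 3 (34) p.264, (43) p.266; King1986, Prop. 3.6 (3.56) p.662] -/
theorem kernelLegPointwiseΦ_of_chartAnalyticLeg {D : AlphaDataT3 F γ} {Φ : ChartFam 𝕍 F} {dist : LegDist F} {κ' κ ρ C_A : ℝ}
    (h : ChartAnalyticΦ D (rescaleΦw dist κ' Φ) κ ρ C_A) : KernelLegPointwiseΦ D Φ dist κ' κ (C_A * (max 1 (12 / ρ)) ^ 6) :=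
  kernelLegPointwiseΦ_of_kernelLegΦ (kernelLegΦ_of_chartAnalyticLeg h)

end Pointwise

end Summit.QuantumFields.YangMills.Theorems.GlobalSlackKernelLeg

end
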